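/-
Copyright (c) 2026 the pub-hodgecm-mathlib formalisation cell (harness21).  Prover seat hodgecm-mathlib-K2E4-p11 (g3), Track B ∕ K2-LIT, h413 =
`stmt-HodgeConjecture-24833`, line `K2_E1_TraceFormulaBeta`, campaign «EIS-RANK-ONE», rung R6d₃, deal (D2-e)-A of K2E1-plan (g4) 2026-09-04T06:27:55Z, the «PoissonInputs»
plumbing block of the assembly `K2E1EisensteinMinusConstantTermBoundedCMThree` (separate file by the 400-line law).
-/
import Summits.HodgeConjecture.HodgeConjecture.Theorems.K2E1EisensteinMinusConstantTermCuspBoundU3   -- ★ p857799 (K2E3-p14 (g4)): the consumer's letters (`hf` in `diagUnit` currency, `hIw`, `hsumN`)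
import Summits.HodgeConjecture.HodgeConjecture.Theorems.K2E1FlatSectionCentreAverageU3             -- ★ p857810 FILE B (+ ★ p857785 FILE A): master majorant, `heisChart_zero`
import Summits.HodgeConjecture.HodgeConjecture.Theorems.K2E1AdelicFourierDecay                    -- ★ p857643 (E2): `exists_forall_tsum_indicator_norm_mul_le_rpow_neg`
import HarnessLib

/-!
# h413 ∕ Track B «K2-LIT», «EIS-RANK-ONE» R6d₃ (D2-e) — `K2E1EisensteinMinusConstantTermPoissonInputsU3`: plumbing for the `U(J₃)` assembly
# (section law ⟹ `N(𝔸)`-invariance; the Heisenberg Iwasawa shape; `hsumN` from the Eisenstein majorant; the (E2) decay bound with a LINEAR constant)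

Cell `pub/hodgecm-mathlib`, crux H413 = `stmt-HodgeConjecture-24833`, route `HCCMUnconditional`; dealer K2E1-plan (g4), deal (D2-e)-A 2026-09-04T06:27:55Z («PoissonInputs block = §1
of the assembly or a separate file — your choice»); REPORT-FIRST 06:31:35Z.  THEOREMS ONLY (no `def`, no `instance`, no `notation`, no named-fact hypothesis, no `sorry`); lane
`--kind proof --supports stmt-HodgeConjecture-24833 --as helper` (count-neutral).  Generic quadratic `(F, E, c)` ∕ generic number field `K`; the CM assembly
`K2E1EisensteinMinusConstantTermBoundedCMThree` imports this file.
* §1 `unipotent_mul_of_borelLaw_diagUnit` — a section obeying the Borel law `f(b g) = χ(d₀(b))·‖d₀(b)‖^z·f(g)` in the `diagUnit hb 0` letters of ★ p857799 is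
  left-`N(𝔸_F)`-invariant (`d₀` of a unipotent element is `1`; any `N`).  `N`-generic twin of ★ p857767's `unipotent_mul_of_borelLaw`.
* §2 `exists_heisChart_torus_of_borel_mul_three` — the Iwasawa shape `g = u(X_u, θ t_u)·t·k` of ★ p857799's `hIw` from `g = b·k` (★ `torusPart`, ★
  `torusPart_inv_mul_mem_adelicUnipotent`, ★ `conj_mem_adelicUnipotent`, ★ `heisChart_coord`, `θ` onto); `N = 3` twin of ★ `exists_chart_torus_of_borel_mul`.
* §3 `summable_norm_weylLongU_heisChart_rat_three` — ★ p857799's `hsumN` (`Σ_{(x₀,τ) ∈ E × F} ‖f(ι(w₀)·u(x₀, τδ)·g)‖ < ∞`) from ★ FILE A's master majorant at `C_X = C = {0}`.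
* §4 `exists_forall_tsum_indicator_norm_mul_le_linear` — ★ (E2) `exists_forall_tsum_indicator_norm_mul_le_rpow_neg` with the decay constant LINEAR in the envelope
  constant `M` (`C(M) = M·C(1)`, by scaling `Ψ ↦ M⁻¹Ψ`): the form in which the per-`x₀` bounds of the centre layer can be summed over the `E`-lattice.
HONEST LABEL.  Count-neutral helper; proves no printed statement; HC_CM is proved only modulo the 7 printed citations (2 remaining named inputs: hLiu418 =
`stmt-HodgeConjecture-24832`, h413 = `stmt-HodgeConjecture-24833`) until rung 0 closes.

## References
* [MoeglinWaldspurger1995] C. Mœglin, J.-L. Waldspurger, *Spectral decomposition and Eisenstein series* (1995), I.2.1, I.2.10–I.2.12, II.1.5, II.1.7.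
* [Rogawski1990] J. D. Rogawski, *Automorphic Representations of Unitary Groups in Three Variables* (1990), §1.10, §2.1.
* [CasselsFrohlichANT1967] J. Tate, *Fourier analysis in number fields and Hecke's zeta-functions*, in Cassels–Fröhlich (1967), Ch. XV §4.2.
* [Garrett2018] P. Garrett, *Modern Analysis of Automorphic Forms by Example* 1 (2018), §2.8–§2.9.
-/

set_option autoImplicit false
set_option linter.dupNamespace false  -- the mandated namespace repeats the summit's segment (`HodgeConjecture.HodgeConjecture`)

noncomputable section

open MeasureTheory Measure Filter Topology NumberField IsDedekindDomain MulAction Module Set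
open Literature.NumberTheory.Automorphic Literature.NumberTheory.Automorphic.UnitaryGroup Literature.NumberTheory.GaloisRepresentations
open Summit.HodgeConjecture.HodgeConjecture.Cruxes.H413.K2E1BorelEisensteinU
open Summit.HodgeConjecture.HodgeConjecture.Cruxes.H413.K2E1FlatSectionLineRestrictionU3
open Summit.HodgeConjecture.HodgeConjecture.Cruxes.H413.K2E1AdelicFourierDecay
open NumberField.mixedEmbedding
-- `Classical` is needed to see the Mathlib normed-space instances on `mixedSpace` (note H5 of `AdelicGLnGlue`)
open scoped ENNReal NNReal Pointwise Classical

namespace Summit.HodgeConjecture.HodgeConjecture.Cruxes.H413.K2E1EisensteinMinusConstantTermPoissonInputsU3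

/-! ## §1 The Borel law in `diagUnit` letters ⟹ left `N(𝔸_F)`-invariance (any `N`) -/

section Quadratic

variable {F E : Type} [Field F] [NumberField F] [Field E] [NumberField E] [Algebra F E] {c : E ≃ₐ[F] E} {N : ℕ} [NeZero N]

/-- **A section obeying the Borel law of a character is left-`N(𝔸_F)`-invariant** (the `diagUnit hb 0` letters of ★ p857799's `hf`): at a unipotent `b = n` the diagonal unit
`d₀(n)` is `1` (★ `coe_diagUnit`, ★ `mem_upperUnitriangular_iff`), so `f(n g) = χ(1)·‖1‖^z·f(g) = f(g)`. [cite: MoeglinWaldspurger1995, II.1.5] -/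
theorem unipotent_mul_of_borelLaw_diagUnit (χ : HeckeCharacter E) (z : ℂ) {f : (quasiSplit F E c N).Adelic → ℂ}
    (hf : ∀ (b g : (quasiSplit F E c N).Adelic) (hb : b ∈ borelAdelic F E c N),
      f (b * g) = ((χ (diagUnit hb 0) : ℂˣ) : ℂ) * ((ideleNorm (diagUnit hb 0) : ℝ) : ℂ) ^ z * f g) :
    ∀ (n : ↥(adelicUnipotent F E c N)) (y : (quasiSplit F E c N).Adelic), f ((n : (quasiSplit F E c N).Adelic) * y) = f y := by
  intro n y
  have hnB : (n : (quasiSplit F E c N).Adelic) ∈ borelAdelic F E c N := adelicUnipotent_le_borelAdelic n.2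
  have hd1 : diagUnit hnB 0 = 1 := by
    refine Units.ext ?_
    rw [coe_diagUnit, Units.val_one]
    exact ((mem_upperUnitriangular_iff _).1 ((mem_adelicUnipotent_iff (n : (quasiSplit F E c N).Adelic)).1 n.2)).2 0
  have h := hf (n : (quasiSplit F E c N).Adelic) y hnB
  rw [hd1, map_one, Units.val_one, ideleNorm_eq_one_of_mem_principalIdeles (Subgroup.one_mem _), Complex.ofReal_one, Complex.one_cpow, one_mul, one_mul] at h
  exact h

/-! ## §2 The Heisenberg Iwasawa shape `g = u(X_u, θ t_u)·t·k` from `g = b·k` -/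

/-- **THE IWASAWA SHAPE OF ★ p857799's `hIw`** from a Borel × `K` decomposition `g = b·k` (`U(J₃)`, any quadratic `(F,E,c)`): `b = (b t_b⁻¹)·t_b` with `b t_b⁻¹ ∈ N(𝔸_F)`
(★ `torusPart`, ★ `torusPart_inv_mul_mem_adelicUnipotent`, ★ `conj_mem_adelicUnipotent`), and every element of `N(𝔸_F)` is `u(X, θ t)` (★ `heisChart_coord`; `θ` is onto ★
`traceZeroLine`). [cite: Rogawski1990, §1.10] [cite: MoeglinWaldspurger1995, I.2.1] -/
theorem exists_heisChart_torus_of_borel_mul_three [Algebra.IsQuadraticExtension F E] (hc : c * c = 1) {δ : E} (hcδ : c δ = -δ) (hδ : δ ≠ 0)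
    {K : Set (quasiSplit F E c 3).Adelic}
    (hIw : ∀ g : (quasiSplit F E c 3).Adelic, ∃ b ∈ borelAdelic F E c 3, ∃ k ∈ K, g = b * k) (g : (quasiSplit F E c 3).Adelic) :
    ∃ (Xu : AdeleRing (𝓞 E) E) (tu : AdeleRing (𝓞 F) F) (t : ↥(torusInBorel F E c 3)), ∃ k ∈ K,
      g = ((heisChart hc (Xu, traceZeroLine F E c hcδ hδ tu) : ↥(adelicUnipotent F E c 3)) : (quasiSplit F E c 3).Adelic) *
        ((t : borelAdelic F E c 3) : (quasiSplit F E c 3).Adelic) * k := by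
  obtain ⟨b, hb, k, hk, rfl⟩ := hIw g
  set B : borelAdelic F E c 3 := ⟨b, hb⟩ with hB
  have ht : torusPart B ∈ torusInBorel F E c 3 := (mem_torusInBorel_iff _).2 (torusPart_mem_torusAdelic B)
  have hu : (((torusPart B)⁻¹ * B : borelAdelic F E c 3) : (quasiSplit F E c 3).Adelic) ∈ adelicUnipotent F E c 3 :=
    torusPart_inv_mul_mem_adelicUnipotent B
  have hconj := conj_mem_adelicUnipotent (Subgroup.inv_mem _ (torusPart B).2) hu
  have hBb : ((B : borelAdelic F E c 3) : (quasiSplit F E c 3).Adelic) = b := rfl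
  have hval : ((((torusPart B : borelAdelic F E c 3)) : (quasiSplit F E c 3).Adelic)⁻¹)⁻¹ *
      ((((torusPart B)⁻¹ * B : borelAdelic F E c 3)) : (quasiSplit F E c 3).Adelic) *
        (((torusPart B : borelAdelic F E c 3)) : (quasiSplit F E c 3).Adelic)⁻¹ =
      b * (((torusPart B : borelAdelic F E c 3)) : (quasiSplit F E c 3).Adelic)⁻¹ := by
    rw [inv_inv, Subgroup.coe_mul, Subgroup.coe_inv, hBb]; group
  rw [hval] at hconj
  -- the unipotent part as a chart point `u(X, θ t)`
  set u : ↥(adelicUnipotent F E c 3) := ⟨_, hconj⟩ with hudef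
  refine ⟨coordX u, (traceZeroLine F E c hcδ hδ).symm (coordY hc u), ⟨torusPart B, ht⟩, k, hk, ?_⟩
  rw [ContinuousAddEquiv.apply_symm_apply, heisChart_coord hc u]
  show b * k = b * (((torusPart B : borelAdelic F E c 3)) : (quasiSplit F E c 3).Adelic)⁻¹ * (((torusPart B : borelAdelic F E c 3)) : (quasiSplit F E c 3).Adelic) * k
  rw [inv_mul_cancel_right]

/-! ## §3 `hsumN` from the Eisenstein majorant -/

/-- **★ p857799's `hsumN`: `Σ_{(x₀,τ) ∈ E × F} ‖f(ι(w₀)·u((x₀)_𝔸, θ τ_𝔸)·g)‖ < ∞`** for a left-`B(F)`-invariant `f` with the locally uniform Eisenstein majorant `hmaj` — ★ FILE A's master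
majorant `exists_summable_majorant_weylLongU_ratHeis_three` at `C_X = C = {0}` (`u(0, θ 0) = 1`, ★ `heisChart_zero`) and comparison. [cite: MoeglinWaldspurger1995, II.1.7]
[cite: Garrett2018, §2.8] -/
theorem summable_norm_weylLongU_heisChart_rat_three [Algebra.IsQuadraticExtension F E] (hc : c * c = 1) {δ : E} (hcδ : c δ = -δ) (hδ : δ ≠ 0)
    {f : (quasiSplit F E c 3).Adelic → ℂ}
    (hfB : ∀ b ∈ borelU (c : E →+* E) ((StdForm.antidiagonal 3).over E), ∀ x : (quasiSplit F E c 3).Adelic, f ((quasiSplit F E c 3).toAdelic b * x) = f x)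
    (hmaj : ∀ y₀ : (quasiSplit F E c 3).Adelic, ∃ V ∈ 𝓝 y₀,
      ∃ u : Quotient (orbitRel ↥(borelU (c : E →+* E) ((StdForm.antidiagonal 3).over E)) ↥(unitaryGroupOfForm (c : E →+* E) ((StdForm.antidiagonal 3).over E))) → ℝ,
        Summable u ∧ ∀ y ∈ V, ∀ q, ‖f ((quasiSplit F E c 3).toAdelic (q.out : ↥(unitaryGroupOfForm (c : E →+* E) ((StdForm.antidiagonal 3).over E))) * y)‖ ≤ u q)
    (g : (quasiSplit F E c 3).Adelic) :
    Summable fun p : E × F => ‖f (((quasiSplit F E c 3).toAdelic (weylLongU (c : E →+* E) (rfl : ((StdForm.antidiagonal 3).over E) = ((StdForm.antidiagonal 3).over E)))) *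
      ((heisChart hc (algebraMap E (AdeleRing (𝓞 E) E) p.1, traceZeroLine F E c hcδ hδ (algebraMap F (AdeleRing (𝓞 F) F) p.2)) : ↥(adelicUnipotent F E c 3)) :
        (quasiSplit F E c 3).Adelic) * g)‖ := by
  obtain ⟨U, hU0, hU, hle⟩ := exists_summable_majorant_weylLongU_ratHeis_three hc hcδ hδ hfB hmaj
    (isCompact_singleton (x := (0 : AdeleRing (𝓞 E) E))) (isCompact_singleton (x := (0 : AdeleRing (𝓞 F) F))) g
  have hθ0 : traceZeroLine F E c hcδ hδ (0 : AdeleRing (𝓞 F) F) = 0 := map_zero _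
  refine Summable.of_nonneg_of_le (fun p => norm_nonneg _) (fun p => ?_) hU
  have h := hle 0 (mem_singleton _) 0 (mem_singleton _) p
  rw [hθ0, heisChart_zero hc, Subgroup.coe_one, one_mul] at h
  simpa only [mul_assoc] using h

end Quadratic

/-! ## §4 The (E2) decay bound with a constant linear in the envelope constant -/

section Linear

variable (K : Type) [Field K] [NumberField K]

/-- **★ (E2) WITH A LINEAR CONSTANT.**  For `d = [K:ℚ] < θ ≤ k` and a compact `C_f` there is `C ≥ 0` such that for EVERY `M ≥ 0` and every `Ψ` with `‖Ψ x‖ ≤ M(1+‖x_∞‖)^{-k}`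
vanishing for `x_f ∉ C_f`, and every idele `t`: `Σ_{ξ∈K} ‖Ψ(ξ t)‖ < ∞` and `Σ_{ξ≠0} ‖Ψ(ξ t)‖ ≤ M·C·|t|^{−θ∕d}` (★ `exists_forall_tsum_indicator_norm_mul_le_rpow_neg` at `M = 1`
applied to `M⁻¹Ψ`). [cite: CasselsFrohlichANT1967, Ch. XV §4.2] [cite: MoeglinWaldspurger1995, II.1.10] -/
theorem exists_forall_tsum_indicator_norm_mul_le_linear {k : ℕ} {Cf : Set (FiniteAdeleRing (𝓞 K) K)} (hCfc : IsCompact Cf)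
    {θ : ℝ} (hθ : (finrank ℚ K : ℝ) < θ) (hθk : θ ≤ k) :
    ∃ C : ℝ, 0 ≤ C ∧ ∀ (M : ℝ), 0 ≤ M → ∀ Ψ : AdeleRing (𝓞 K) K → ℂ,
      (∀ x, ‖Ψ x‖ ≤ M * (1 + ‖InfiniteAdeleRing.ringEquiv_mixedSpace K x.1‖) ^ (-(k : ℝ))) → (∀ x, x.2 ∉ Cf → Ψ x = 0) →
      ∀ t : ideleGroup K,
        Summable (fun ξ : K => ‖Ψ (algebraMap K (AdeleRing (𝓞 K) K) ξ * (t : AdeleRing (𝓞 K) K))‖) ∧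
        ∑' ξ : K, ({0}ᶜ : Set K).indicator (fun ξ => ‖Ψ (algebraMap K (AdeleRing (𝓞 K) K) ξ * (t : AdeleRing (𝓞 K) K))‖) ξ ≤
          M * C * (((IdeleClassGroup.ideleNorm K t : ℝ≥0) : ℝ)) ^ (-(θ / (finrank ℚ K : ℝ))) := by
  obtain ⟨C, hC0, hC⟩ := exists_forall_tsum_indicator_norm_mul_le_rpow_neg K (zero_le_one : (0 : ℝ) ≤ 1) hCfc hθ hθk
  refine ⟨C, hC0, fun M hM Ψ hΨ hΨf t => ?_⟩
  rcases hM.eq_or_lt with hM0 | hMpos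
  · -- `M = 0`: `Ψ = 0`
    have hΨ0 : ∀ x, Ψ x = 0 := fun x => by
      have h := hΨ x
      rw [← hM0, zero_mul] at h
      exact norm_le_zero_iff.1 h
    have hfun : (fun ξ : K => ‖Ψ (algebraMap K (AdeleRing (𝓞 K) K) ξ * (t : AdeleRing (𝓞 K) K))‖) = fun _ => 0 := funext fun ξ => by rw [hΨ0, norm_zero]
    have hind : (fun ξ : K => ({0}ᶜ : Set K).indicator (fun ξ => ‖Ψ (algebraMap K (AdeleRing (𝓞 K) K) ξ * (t : AdeleRing (𝓞 K) K))‖) ξ) = fun _ => 0 :=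
      funext fun ξ => by rw [hfun, Set.indicator_apply]; split_ifs <;> rfl
    refine ⟨?_, ?_⟩
    · rw [hfun]; exact summable_zero
    · rw [hind, tsum_zero, ← hM0, zero_mul, zero_mul]
  · -- `M > 0`: scale by `M⁻¹`
    set Ψ' : AdeleRing (𝓞 K) K → ℂ := fun x => ((M⁻¹ : ℝ) : ℂ) * Ψ x with hΨ'
    have hnorm : ∀ x, ‖Ψ' x‖ = M⁻¹ * ‖Ψ x‖ := fun x => by
      show ‖((M⁻¹ : ℝ) : ℂ) * Ψ x‖ = _
      rw [norm_mul, Complex.norm_real, Real.norm_of_nonneg (inv_nonneg.2 hM)]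
    have hΨ'b : ∀ x, ‖Ψ' x‖ ≤ 1 * (1 + ‖InfiniteAdeleRing.ringEquiv_mixedSpace K x.1‖) ^ (-(k : ℝ)) := fun x => by
      rw [hnorm, one_mul, inv_mul_le_iff₀ hMpos]
      exact hΨ x
    have hΨ'f : ∀ x, x.2 ∉ Cf → Ψ' x = 0 := fun x hx => by
      show ((M⁻¹ : ℝ) : ℂ) * Ψ x = 0
      rw [hΨf x hx, mul_zero]
    obtain ⟨hs, hle⟩ := hC Ψ' hΨ'b hΨ'f t
    have hrel : ∀ ξ : K, ‖Ψ (algebraMap K (AdeleRing (𝓞 K) K) ξ * (t : AdeleRing (𝓞 K) K))‖ = M * ‖Ψ' (algebraMap K (AdeleRing (𝓞 K) K) ξ * (t : AdeleRing (𝓞 K) K))‖ :=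
      fun ξ => by rw [hnorm, ← mul_assoc, mul_inv_cancel₀ hMpos.ne', one_mul]
    refine ⟨(hs.mul_left M).congr fun ξ => (hrel ξ).symm, ?_⟩
    have hind : (fun ξ : K => ({0}ᶜ : Set K).indicator (fun ξ => ‖Ψ (algebraMap K (AdeleRing (𝓞 K) K) ξ * (t : AdeleRing (𝓞 K) K))‖) ξ) =
        fun ξ : K => M * ({0}ᶜ : Set K).indicator (fun ξ => ‖Ψ' (algebraMap K (AdeleRing (𝓞 K) K) ξ * (t : AdeleRing (𝓞 K) K))‖) ξ := by
      funext ξ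
      by_cases hξ : ξ ∈ ({0}ᶜ : Set K)
      · rw [Set.indicator_of_mem hξ, Set.indicator_of_mem hξ, hrel]
      · rw [Set.indicator_of_notMem hξ, Set.indicator_of_notMem hξ, mul_zero]
    rw [hind, tsum_mul_left, mul_assoc]
    exact mul_le_mul_of_nonneg_left hle hM

end Linear

end Summit.HodgeConjecture.HodgeConjecture.Cruxes.H413.K2E1EisensteinMinusConstantTermPoissonInputsU3

end
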